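import Summits.QuantumFields.YangMills.Theorems.UnitScaleTiltProp7MemberBallFrames
import Summits.QuantumFields.YangMills.Theorems.UnitScaleTiltProp7ConjFrameReg335
import HarnessLib

/-!
# Route `UnitScaleTilt`, crux K1 «MinimiserStabilityRegPr» (stmt-QuantumFields-19200), route-R E′ path (α′), (E1-b) covariant — THE BALL FRAME RE-BASED AT ITS CENTRE:
# ✓ `Prop7MemberBallFrames.exists_ballFrame_of_regPr` (px4 g3, p672574) with the extra clause `Fr x₀ = 1`

Cell `ym3-torus`, extra width seat `ym-routeR-w4` (g10); offer «REBASE» (bus 2026-08-28T22:08Z), GO-gated on ym-routeR-w6 g6's (N-cov) framed-transplant shape.  THEOREMS ONLY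
(0 `def`, 0 `sorry`); `--supports stmt-QuantumFields-19200`, count-neutral.  YM₃ on T³ is a ladder rung (R3), not the Clay problem; nothing here claims a stub, the crux,
d = 4 or the mass gap.

WHY.  The (N-cov) near field of routeR-w6 g6's LOCATE-PCOV2 §4(iii) is a FRAMED TRANSPLANT `V_U := χ_{ball}·R(Fr)(V_flat)` of the flat pre-solution on the bond ball
`B(b₋, 2ℓ_k + 2)`; with `Fr(b₋) = 1` the transported source at the base point is the flat one VERBATIM (no `R(Fr(b₋))` on the datum).  Re-basing costs nothing: multiply the
frame by the CONSTANT unit `(Fr x₀)⁻¹` on the right; the framed links get conjugated by a bi-contractive constant, which does not increase `‖· − 1‖` or `‖· − ·‖`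
(✓ `B9Eq335PlaquetteAtLettersY.norm_conj_sub_one_le`, ✓ `Prop7ConjFrameReg335.norm_conj_sub_conj_le`).

WHAT IS PROVED (ns `…Theorems.Prop7MemberBallFramesBased`).
* §1 (any ring ∕ normed ring; a frame `Fr : S → 𝔸ˣ`, base point `x₀`, re-based frame `Fr′ z := Fr z · (Fr x₀)⁻¹`): `rebase_base` (`Fr′ x₀ = 1`), `rebase_hol_eq`
  (`(Fr′ x)⁻¹·U·Fr′ y = v⁻¹·((Fr x)⁻¹·U·Fr y)·v`, `v := (Fr x₀)⁻¹`), `rebase_bicontr`, ★ `rebase_size_le` (`‖(Fr′ x)⁻¹UFr′ y − 1‖ ≤ ‖(Fr x)⁻¹UFr y − 1‖`),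
  ★ `rebase_diff_le` (`‖h′ − k′‖ ≤ ‖h − k‖` for two framed links).
* §2 ★★ `exists_ballFrame_of_regPr_based` — ✓ `exists_ballFrame_of_regPr` VERBATIM plus the conjunct `Fr x₀ = 1`: for `W ∈ RegPr` (`M·α₀ ≤ a₅`), every `x₀` and every `r`
  with `2r + 4 ≤ bigSide`, a frame bi-contractive everywhere, `= 1` at `x₀`, with the SIZE row `τ₁` and the ALL-DIRECTION DIFFERENCE row `τ₂` on the ball `tdist(x, x₀) ≤ r`
  (`τ₁ = ηC′e^{ηC′}`, `τ₂ = η(ηC′)e^{ηC′}`, `η = (L^{K−n})⁻¹`, `C′ = c35·(L·L^{a′})·α₀` — ✓p663714's `a₀ a₁` token-for-token).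
HONEST SCOPE.  Bookkeeping ([folklore] conjugation algebra) over ✓p672574; no analytic content.

References: T. Bałaban, CMP 99 (1985) 389–434 [Balaban1985BackgroundPropagators] ((3.28) p.395, (3.35) p.396); CMP 99 (1985) 75–102 [Balaban1985RegularSpaces] ((1.33) p.82, Prop. 6 p.99).
-/

set_option autoImplicit false

noncomputable section

open scoped Matrix.Norms.L2Operator

namespace Summit.QuantumFields.YangMills.Theorems.Prop7MemberBallFramesBased

open Literature.MathematicalPhysics.QuantumFieldTheory.Balaban1983to89
open Literature.MathematicalPhysics.QuantumFieldTheory.Balaban1983to89.T3ContinuumYM3Torus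
open Literature.MathematicalPhysics.QuantumFieldTheory.Balaban1983to89.T3PrintedRegularMinimiser (RegPr)
open Literature.MathematicalPhysics.QuantumFieldTheory.Balaban1983to89.B6GlobalChartV1 (PV)
open B9TorusCalculus (torusT)
open B6MultiLevelBoxOperator (bigSide)
open B10Eq27TorusAxialLog (unitsField toUField)
open B9Thm310CommutatorDataOfPlaquettes (bicontr_mul bicontr_inv)
open B9Eq335PlaquetteAtLettersY (norm_conj_sub_one_le)
open Summit.QuantumFields.YangMills.Theorems.Prop7SectET3Members (hd3)
open Summit.QuantumFields.YangMills.Theorems.Prop7ConjFrameReg335 (norm_conj_sub_conj_le)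
open Summit.QuantumFields.YangMills.Theorems.Prop7MemberBallFrames (exists_ballFrame_of_regPr)

/-! ## §1 Re-basing a frame at a point (conjugation by a bi-contractive constant) -/

section Rebase

variable {𝔸 : Type*} [Ring 𝔸] {S : Type*}

/-- The re-based frame is `1` at the base point. [folklore] -/
theorem rebase_base (Fr : S → 𝔸ˣ) (x₀ : S) : (fun z => Fr z * (Fr x₀)⁻¹) x₀ = 1 := by
  simp

/-- The re-based framed link is the constant conjugate of the framed link: `(Fr′ x)⁻¹·U·Fr′ y = v⁻¹·((Fr x)⁻¹·U·Fr y)·v` with `v := (Fr x₀)⁻¹`.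
[cite: Balaban1985BackgroundPropagators, (3.28) p.395, bookkeeping] -/
theorem rebase_hol_eq (Fr : S → 𝔸ˣ) (x₀ x y : S) (U : 𝔸ˣ) :
    ((fun z => Fr z * (Fr x₀)⁻¹) x)⁻¹ * U * (fun z => Fr z * (Fr x₀)⁻¹) y = ((Fr x₀)⁻¹)⁻¹ * ((Fr x)⁻¹ * U * Fr y) * (Fr x₀)⁻¹ := by
  simp only [mul_inv_rev, inv_inv, mul_assoc]

end Rebase

section RebaseNorm

variable {𝔸 : Type} [NormedRing 𝔸] {S : Type*}

/-- The re-based frame is bi-contractive everywhere when the frame is. [cite: Balaban1985BackgroundPropagators, (3.1) p.390, bookkeeping] -/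
theorem rebase_bicontr {Fr : S → 𝔸ˣ} (hFr : ∀ z, ‖(Fr z : 𝔸)‖ ≤ 1 ∧ ‖(((Fr z)⁻¹ : 𝔸ˣ) : 𝔸)‖ ≤ 1) (x₀ z : S) :
    ‖(((fun z => Fr z * (Fr x₀)⁻¹) z : 𝔸ˣ) : 𝔸)‖ ≤ 1 ∧ ‖((((fun z => Fr z * (Fr x₀)⁻¹) z)⁻¹ : 𝔸ˣ) : 𝔸)‖ ≤ 1 :=
  bicontr_mul (hFr z) (bicontr_inv (hFr x₀))

/-- ★ Re-basing does not increase the SIZE row: `‖(Fr′ x)⁻¹·U·Fr′ y − 1‖ ≤ ‖(Fr x)⁻¹·U·Fr y − 1‖`. [cite: Balaban1985BackgroundPropagators, (3.35) p.396, bookkeeping] -/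
theorem rebase_size_le {Fr : S → 𝔸ˣ} (hFr : ∀ z, ‖(Fr z : 𝔸)‖ ≤ 1 ∧ ‖(((Fr z)⁻¹ : 𝔸ˣ) : 𝔸)‖ ≤ 1) (x₀ x y : S) (U : 𝔸ˣ) :
    ‖((((fun z => Fr z * (Fr x₀)⁻¹) x)⁻¹ * U * (fun z => Fr z * (Fr x₀)⁻¹) y : 𝔸ˣ) : 𝔸) - 1‖ ≤ ‖(((Fr x)⁻¹ * U * Fr y : 𝔸ˣ) : 𝔸) - 1‖ := by
  rw [rebase_hol_eq]
  exact norm_conj_sub_one_le (bicontr_inv (hFr x₀)) _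

/-- ★ Re-basing does not increase the DIFFERENCE row: `‖h′ − k′‖ ≤ ‖h − k‖` for two framed links `h = (Fr x)⁻¹UFr y`, `k = (Fr x′)⁻¹U′Fr y′`.
[cite: Balaban1985BackgroundPropagators, (3.35) p.396, bookkeeping] -/
theorem rebase_diff_le {Fr : S → 𝔸ˣ} (hFr : ∀ z, ‖(Fr z : 𝔸)‖ ≤ 1 ∧ ‖(((Fr z)⁻¹ : 𝔸ˣ) : 𝔸)‖ ≤ 1) (x₀ x y x' y' : S) (U U' : 𝔸ˣ) :
    ‖((((fun z => Fr z * (Fr x₀)⁻¹) x)⁻¹ * U * (fun z => Fr z * (Fr x₀)⁻¹) y : 𝔸ˣ) : 𝔸)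
        - ((((fun z => Fr z * (Fr x₀)⁻¹) x')⁻¹ * U' * (fun z => Fr z * (Fr x₀)⁻¹) y' : 𝔸ˣ) : 𝔸)‖
      ≤ ‖(((Fr x)⁻¹ * U * Fr y : 𝔸ˣ) : 𝔸) - (((Fr x')⁻¹ * U' * Fr y' : 𝔸ˣ) : 𝔸)‖ := by
  rw [rebase_hol_eq, rebase_hol_eq]
  exact norm_conj_sub_conj_le (bicontr_inv (hFr x₀)) _ _

end RebaseNorm

/-! ## §2 ★★ The ball frame at the member, re-based at the centre -/

section Member

variable {ℓ : ℕ} {hL : Odd (ℓ + 1) ∧ 1 < ℓ + 1}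

/-- ★★ **(3.35) FRAMES ON A `tdist`-BALL AT THE MEMBER, TRIVIAL AT THE CENTRE** — ✓ `Prop7MemberBallFrames.exists_ballFrame_of_regPr` plus `Fr x₀ = 1` (see the module docstring).
[cite: Balaban1985RegularSpaces, (1.33) p.82, Prop. 6 p.99; Balaban1985BackgroundPropagators, (3.35) p.396, (3.28) p.395; Balaban1985Variational, Sect. A p.280] -/
theorem exists_ballFrame_of_regPr_based (hℓ4 : 4 ≤ ℓ) :
    ∃ c35 a₅ : ℝ, 0 < c35 ∧ 0 < a₅ ∧
      ∀ (hℓ : 4 ≤ ℓ) (m : ℕ) (hm : 1 ≤ m) (n K a' R : ℕ) (hk1 : 1 ≤ K - n) (hsize : a' + 3 ≤ m + n) (hM8 : 8 ≤ (ℓ + 1) ^ a')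
        (hR2 : 2 * (ℓ + 1) ^ 2 ≤ R) (α₀ : ℝ), 0 < α₀ → ((ℓ + 1 : ℕ) : ℝ) * (((ℓ + 1) ^ a' : ℕ) : ℝ) * α₀ ≤ a₅ →
        ∀ W : GaugeField (PV 2 ℓ m K hd3 hL) 0 (Matrix.specialUnitaryGroup (Fin 2) ℂ),
          RegPr (⟨ℓ + 1, hL, m, hm⟩ : T3Family) n K α₀ W →
          ∀ (x₀ : Site (PV 2 ℓ m K hd3 hL) 0) (r : ℕ), 2 * r + 4 ≤ bigSide ℓ ((ℓ + 1) ^ a') (K - n) →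
            ∃ Fr : Site (PV 2 ℓ m K hd3 hL) 0 → (Matrix (Fin 2) (Fin 2) ℂ)ˣ,
              (∀ z : Site (PV 2 ℓ m K hd3 hL) 0, ‖(Fr z : Matrix (Fin 2) (Fin 2) ℂ)‖ ≤ 1 ∧ ‖(((Fr z)⁻¹ : (Matrix (Fin 2) (Fin 2) ℂ)ˣ) : Matrix (Fin 2) (Fin 2) ℂ)‖ ≤ 1) ∧
              Fr x₀ = 1 ∧
              (∀ (μ : Fin (PV 2 ℓ m K hd3 hL).d) (x : Site (PV 2 ℓ m K hd3 hL) 0), Site.tdist x x₀ ≤ r →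
                ‖(((Fr x)⁻¹ * unitsField (toUField W) ⟨x, μ⟩ * Fr (torusT (PV 2 ℓ m K hd3 hL) 0 μ x) : (Matrix (Fin 2) (Fin 2) ℂ)ˣ) : Matrix (Fin 2) (Fin 2) ℂ) - 1‖
                  ≤ (((ℓ + 1 : ℕ) : ℝ) ^ (K - n))⁻¹ * (c35 * (((ℓ + 1 : ℕ) : ℝ) * (((ℓ + 1) ^ a' : ℕ) : ℝ)) * α₀)
                      * Real.exp ((((ℓ + 1 : ℕ) : ℝ) ^ (K - n))⁻¹ * (c35 * (((ℓ + 1 : ℕ) : ℝ) * (((ℓ + 1) ^ a' : ℕ) : ℝ)) * α₀))) ∧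
              (∀ (μ ν : Fin (PV 2 ℓ m K hd3 hL).d) (x : Site (PV 2 ℓ m K hd3 hL) 0), Site.tdist x x₀ ≤ r →
                ‖(((Fr (torusT (PV 2 ℓ m K hd3 hL) 0 ν x))⁻¹ * unitsField (toUField W) ⟨torusT (PV 2 ℓ m K hd3 hL) 0 ν x, μ⟩
                      * Fr (torusT (PV 2 ℓ m K hd3 hL) 0 μ (torusT (PV 2 ℓ m K hd3 hL) 0 ν x)) : (Matrix (Fin 2) (Fin 2) ℂ)ˣ) : Matrix (Fin 2) (Fin 2) ℂ)
                    - (((Fr x)⁻¹ * unitsField (toUField W) ⟨x, μ⟩ * Fr (torusT (PV 2 ℓ m K hd3 hL) 0 μ x) : (Matrix (Fin 2) (Fin 2) ℂ)ˣ) : Matrix (Fin 2) (Fin 2) ℂ)‖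
                  ≤ (((ℓ + 1 : ℕ) : ℝ) ^ (K - n))⁻¹ * ((((ℓ + 1 : ℕ) : ℝ) ^ (K - n))⁻¹ * (c35 * (((ℓ + 1 : ℕ) : ℝ) * (((ℓ + 1) ^ a' : ℕ) : ℝ)) * α₀))
                      * Real.exp ((((ℓ + 1 : ℕ) : ℝ) ^ (K - n))⁻¹ * (c35 * (((ℓ + 1 : ℕ) : ℝ) * (((ℓ + 1) ^ a' : ℕ) : ℝ)) * α₀))) := by
  obtain ⟨c35, a₅, hc35, ha₅, H⟩ := exists_ballFrame_of_regPr (hL := hL) hℓ4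
  refine ⟨c35, a₅, hc35, ha₅, ?_⟩
  intro hℓ m hm n K a' R hk1 hsize hM8 hR2 α₀ hα₀ hMα W hreg x₀ r hr
  obtain ⟨Fr, hFr, hsize', hdiff⟩ := H hℓ m hm n K a' R hk1 hsize hM8 hR2 α₀ hα₀ hMα W hreg x₀ r hr
  refine ⟨fun z => Fr z * (Fr x₀)⁻¹, fun z => rebase_bicontr hFr x₀ z, rebase_base Fr x₀, fun μ x hx => ?_, fun μ ν x hx => ?_⟩
  · exact (rebase_size_le hFr x₀ _ _ _).trans (hsize' μ x hx)
  · exact (rebase_diff_le hFr x₀ _ _ _ _ _ _).trans (hdiff μ ν x hx)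

end Member

end Summit.QuantumFields.YangMills.Theorems.Prop7MemberBallFramesBased

end
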